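import Literature.Analysis.FluidPDE.LocalTypeIProofs
import Literature.Analysis.FluidPDE.ESSLocalHolderBlowupLimit
import Literature.Analysis.FluidPDE.AxisymmetricTypeIAxis
import Summits.NavierStokesRegularity.NavierStokesRegularity.Theorems.SqueezeCycleRecurrentLiouvilleAxisymRegular
import HarnessLib

/-!
# Route QuantisedSymmetry, item `QuantisedOrder` (stmt-NavierStokesRegularity-11293) — IV:
# bookkeeping for the parabolic zoom `Q(0, ½) → Q(0, 2) ⊇ 𝒞 × ]-1, 0[`

Transport lemmas used to feed the Seregin–Šverák barrier (stated on the unit space–time cylinder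
`ssCylinder = 𝒞 × ]-1, 0[`) with the zoomed field `u_c(s, y) = c u(c² s, c y)`
(`c • stPull (c²) c 0 0 u`, `SpaceTimeRescaling.lean`):

* backward singular points at the origin are stable under a.e. modification on a parabolic ball
  about the origin and under the zoom (`eLpNorm_top_nsZoom`);
* `ssCylinder ⊆ Q(0, 2)` as `Opens` (the set inclusion is the tree's `rlAxisymRegular_ssCylinder_subset`);
* slice-wise axisymmetry, the a.e. Type I bound `√(-t) |u| ≤ C` and the `L³` / `L^{3/2}` classes
  pass to the zoomed pair (change of variables `map_stAffine_volume_restrict_preimage`);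
* the a.e. Type I bound passes to `L³` limits (a.e. convergent subsequence).

Nothing here is specific to the Navier–Stokes equations beyond the vocabulary.

## References

* G. Seregin, V. Šverák, Comm. PDE 34 (2009) = arXiv:0804.1803, Thm. 3.1, §3. [SereginSverak2009]
* D. Albritton, T. Barker, arXiv:1811.00502, §1, Def. 2.1 (the class `IsSuitableWeakSolutionInBall`). [AlbrittonBarker2019]
-/

set_option linter.dupNamespace false

noncomputable section

open MeasureTheory Set Function Filter Topology Metric
open scoped ENNReal NNReal

namespace Summit.NavierStokesRegularity.NavierStokesRegularity.Theorems.QuantisedOrder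

open Literature.Analysis.FluidPDE Literature.Barriers.NavierStokesRegularity

/-! ### Backward singular points at the origin -/

/-- A backward singular point at the space–time origin survives a.e. modification of the field on
a parabolic ball `Q(0, R)`, `R > 0` (small balls lie inside `Q(0, R)`; large ones contain it).
[folklore] -/
theorem isBackwardSingularPoint_zero_of_ae_eq {R : ℝ} (hR : 0 < R)
    {u u' : ℝ → EuclideanSpace ℝ (Fin 3) → EuclideanSpace ℝ (Fin 3)}
    (h : ∀ᵐ z ∂((volume : Measure (ℝ × EuclideanSpace ℝ (Fin 3))).restrict
        (parabolicCylinder R (0 : ℝ × EuclideanSpace ℝ (Fin 3)))), uncurry u z = uncurry u' z)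
    (hs : IsBackwardSingularPoint u 0) : IsBackwardSingularPoint u' 0 := by
  intro r hr
  by_cases hrR : r ≤ R
  · have hsub := SuitableCompactness.parabolicCylinder_zero_mono hr.le hrR
    have h' : uncurry u' =ᵐ[(volume : Measure (ℝ × EuclideanSpace ℝ (Fin 3))).restrict
        (parabolicCylinder r (0 : ℝ × EuclideanSpace ℝ (Fin 3)))] uncurry u :=
      (ae_restrict_of_ae_restrict_of_subset hsub h).mono fun z hz => hz.symm
    rw [eLpNorm_congr_ae h']
    exact hs r hr
  · have hrR' : R < r := not_le.1 hrR
    have hsub := SuitableCompactness.parabolicCylinder_zero_mono hR.le hrR'.le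
    have h' : uncurry u =ᵐ[(volume : Measure (ℝ × EuclideanSpace ℝ (Fin 3))).restrict
        (parabolicCylinder R (0 : ℝ × EuclideanSpace ℝ (Fin 3)))] uncurry u' := h
    refine top_le_iff.1 ?_
    calc (⊤ : ℝ≥0∞) = eLpNorm (uncurry u) ∞ ((volume : Measure (ℝ × EuclideanSpace ℝ (Fin 3))).restrict
          (parabolicCylinder R (0 : ℝ × EuclideanSpace ℝ (Fin 3)))) := (hs R hR).symm
      _ = eLpNorm (uncurry u') ∞ ((volume : Measure (ℝ × EuclideanSpace ℝ (Fin 3))).restrict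
          (parabolicCylinder R (0 : ℝ × EuclideanSpace ℝ (Fin 3)))) := eLpNorm_congr_ae h'
      _ ≤ eLpNorm (uncurry u') ∞ ((volume : Measure (ℝ × EuclideanSpace ℝ (Fin 3))).restrict
          (parabolicCylinder r (0 : ℝ × EuclideanSpace ℝ (Fin 3)))) :=
        eLpNorm_mono_measure _ (Measure.restrict_mono hsub le_rfl)

/-- A backward singular point at the origin survives the parabolic zoom `u ↦ c u(c²·, c·)`,
`c > 0` (`‖u_c‖_{L^∞(Q(0,r))} = c ‖u‖_{L^∞(Q(0,cr))}`). [folklore] -/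
theorem isBackwardSingularPoint_zero_zoom {c : ℝ} (hc : 0 < c)
    {u : ℝ → EuclideanSpace ℝ (Fin 3) → EuclideanSpace ℝ (Fin 3)}
    (hs : IsBackwardSingularPoint u 0) :
    IsBackwardSingularPoint (c • stPull (c ^ 2) c 0 (0 : EuclideanSpace ℝ (Fin 3)) u) 0 := by
  intro r hr
  rw [eLpNorm_top_nsZoom hc 0 0 r 0 u]
  have h0 : stAffine (c ^ 2) c 0 (0 : EuclideanSpace ℝ (Fin 3)) 0 = 0 := by
    simp [stAffine, Prod.ext_iff]
  rw [h0, hs (c * r) (mul_pos hc hr)]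
  exact ENNReal.mul_top (ENNReal.ofReal_pos.2 hc).ne'

/-! ### The unit cylinder inside `Q(0, 2)` -/

/-- `𝒞 × ]-1, 0[ ⊆ Q(0, 2)` (the tree's `rlAxisymRegular_ssCylinder_subset`), for the `Opens`.
[folklore] -/
theorem ssCylinderOpens_le_parabolicCylinderOpens_two :
    ssCylinderOpens ≤ parabolicCylinderOpens 2 (0 : ℝ × EuclideanSpace ℝ (Fin 3)) :=
  fun _ hz => rlAxisymRegular_ssCylinder_subset hz

/-! ### The zoomed pair -/

/-- Slice-wise axisymmetry passes to the zoomed field (rotations are linear and fix the origin).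
[folklore] -/
theorem isAxisymmetric_zoom {c : ℝ} {u : ℝ → EuclideanSpace ℝ (Fin 3) → EuclideanSpace ℝ (Fin 3)}
    (hu : ∀ t, IsAxisymmetric (u t)) (s : ℝ) :
    IsAxisymmetric ((c • stPull (c ^ 2) c 0 (0 : EuclideanSpace ℝ (Fin 3)) u) s) := by
  intro θ y
  simp only [smul_stPull_apply, zero_add]
  have e1 : c • rotZ θ y = rotZ θ (c • y) := (map_smul (rotZL θ) c y).symm
  rw [e1, hu _ θ (c • y)]
  exact (map_smul (rotZL θ) c _).symm

/-- A.e. statements on `Q(0, R)` pull back to `Q(0, R/c)` along the zoom map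
`(s, y) ↦ (c² s, c y)`. [folklore] -/
theorem ae_restrict_comp_zoom {c : ℝ} (hc : 0 < c) (R : ℝ) {P : ℝ × EuclideanSpace ℝ (Fin 3) → Prop}
    (h : ∀ᵐ w ∂((volume : Measure (ℝ × EuclideanSpace ℝ (Fin 3))).restrict
        (parabolicCylinder R (0 : ℝ × EuclideanSpace ℝ (Fin 3)))), P w) :
    ∀ᵐ z ∂((volume : Measure (ℝ × EuclideanSpace ℝ (Fin 3))).restrict
        (parabolicCylinder (R / c) (0 : ℝ × EuclideanSpace ℝ (Fin 3)))),
      P (stAffine (c ^ 2) c 0 (0 : EuclideanSpace ℝ (Fin 3)) z) := by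
  have hβ : 0 < c ^ 2 := pow_pos hc 2
  have hq : Measure.QuasiMeasurePreserving (stAffine (c ^ 2) c 0 (0 : EuclideanSpace ℝ (Fin 3)))
      ((volume : Measure (ℝ × EuclideanSpace ℝ (Fin 3))).restrict
        (stAffine (c ^ 2) c 0 (0 : EuclideanSpace ℝ (Fin 3)) ⁻¹'
          parabolicCylinder R (0 : ℝ × EuclideanSpace ℝ (Fin 3))))
      ((volume : Measure (ℝ × EuclideanSpace ℝ (Fin 3))).restrict
        (parabolicCylinder R (0 : ℝ × EuclideanSpace ℝ (Fin 3)))) := by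
    refine ⟨measurable_stAffine _ _ _ _, ?_⟩
    rw [map_stAffine_volume_restrict_preimage hβ hc]
    exact Measure.smul_absolutelyContinuous
  rw [← stAffine_preimage_parabolicCylinder_zero hc R]
  exact hq.ae h

/-- The a.e. Type I bound `√(-t) |u| ≤ C` on `Q(0, R)` passes to the zoomed field on `Q(0, R/c)`.
[folklore] -/
theorem ae_typeI_zoom {c : ℝ} (hc : 0 < c) {R C : ℝ}
    {u : ℝ → EuclideanSpace ℝ (Fin 3) → EuclideanSpace ℝ (Fin 3)}
    (h : ∀ᵐ w ∂((volume : Measure (ℝ × EuclideanSpace ℝ (Fin 3))).restrict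
        (parabolicCylinder R (0 : ℝ × EuclideanSpace ℝ (Fin 3)))), Real.sqrt (-w.1) * ‖u w.1 w.2‖ ≤ C) :
    ∀ᵐ z ∂((volume : Measure (ℝ × EuclideanSpace ℝ (Fin 3))).restrict
        (parabolicCylinder (R / c) (0 : ℝ × EuclideanSpace ℝ (Fin 3)))),
      Real.sqrt (-z.1) * ‖(c • stPull (c ^ 2) c 0 (0 : EuclideanSpace ℝ (Fin 3)) u) z.1 z.2‖ ≤ C := by
  filter_upwards [ae_restrict_comp_zoom hc R h] with z hz
  rw [smul_stPull_apply, norm_smul, Real.norm_eq_abs, abs_of_pos hc, zero_add, zero_add]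
  have e : Real.sqrt (-z.1) * (c * ‖u (c ^ 2 * z.1) (c • z.2)‖) =
      Real.sqrt (-(c ^ 2 * z.1)) * ‖u (c ^ 2 * z.1) (c • z.2)‖ := by
    rw [show -(c ^ 2 * z.1) = c ^ 2 * (-z.1) by ring, Real.sqrt_mul (pow_nonneg hc.le 2),
      Real.sqrt_sq hc.le]
    ring
  rw [e]
  have hz' : Real.sqrt (-(0 + c ^ 2 * z.1)) * ‖u (0 + c ^ 2 * z.1) ((0 : EuclideanSpace ℝ (Fin 3)) + c • z.2)‖ ≤ C := hz
  simpa only [zero_add] using hz'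

/-- The `L³(Q(0, R))` class of the velocity passes to `L³(Q(0, R/c))` for the zoomed field, in the
form `∫ |u_c|³ < ∞` on any subset. [folklore] -/
theorem lintegral_cube_zoom_lt_top {c : ℝ} (hc : 0 < c) {R : ℝ}
    {u : ℝ → EuclideanSpace ℝ (Fin 3) → EuclideanSpace ℝ (Fin 3)}
    (hu : MemLp (uncurry u) 3 ((volume : Measure (ℝ × EuclideanSpace ℝ (Fin 3))).restrict
        (parabolicCylinder R (0 : ℝ × EuclideanSpace ℝ (Fin 3)))))
    {S : Set (ℝ × EuclideanSpace ℝ (Fin 3))}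
    (hS : S ⊆ parabolicCylinder (R / c) (0 : ℝ × EuclideanSpace ℝ (Fin 3))) :
    ∫⁻ z in S, ‖(c • stPull (c ^ 2) c 0 (0 : EuclideanSpace ℝ (Fin 3)) u) z.1 z.2‖ₑ ^ (3 : ℕ) < ⊤ := by
  have hm : MemLp (uncurry (c • stPull (c ^ 2) c 0 (0 : EuclideanSpace ℝ (Fin 3)) u)) 3
      ((volume : Measure (ℝ × EuclideanSpace ℝ (Fin 3))).restrict
        (parabolicCylinder (R / c) (0 : ℝ × EuclideanSpace ℝ (Fin 3)))) := by
    have e : uncurry (c • stPull (c ^ 2) c 0 (0 : EuclideanSpace ℝ (Fin 3)) u) =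
        c • (uncurry u ∘ stAffine (c ^ 2) c 0 (0 : EuclideanSpace ℝ (Fin 3))) := by
      funext z; rfl
    rw [e]
    exact (memLp_comp_zoom hc (by norm_num) (by norm_num) hu).const_smul c
  have h3 := lintegral_rpow_enorm_lt_top_of_eLpNorm_lt_top (by norm_num) (by norm_num) hm.eLpNorm_lt_top
  have e3 : ∀ x : ℝ≥0∞, x ^ (3 : ℕ) = x ^ (3 : ℝ≥0∞).toReal := fun x => by
    rw [ENNReal.toReal_ofNat, show (3 : ℝ) = ((3 : ℕ) : ℝ) by norm_num, ENNReal.rpow_natCast]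
  simp only [e3]
  exact lt_of_le_of_lt (lintegral_mono_set hS) h3

/-- The `L^{3/2}` class of the zoomed pressure on `Q(0, R')` in the form `∫ |p|^{3/2} < ∞` on any
subset. [folklore] -/
theorem lintegral_threeHalves_lt_top_of_memLp {R' : ℝ} {p : ℝ → EuclideanSpace ℝ (Fin 3) → ℝ}
    (hp : MemLp (uncurry p) (3 / 2) ((volume : Measure (ℝ × EuclideanSpace ℝ (Fin 3))).restrict
        (parabolicCylinder R' (0 : ℝ × EuclideanSpace ℝ (Fin 3)))))
    {S : Set (ℝ × EuclideanSpace ℝ (Fin 3))}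
    (hS : S ⊆ parabolicCylinder R' (0 : ℝ × EuclideanSpace ℝ (Fin 3))) :
    ∫⁻ z in S, ‖p z.1 z.2‖ₑ ^ (3 / 2 : ℝ) < ⊤ := by
  have h32 : (3 / 2 : ℝ≥0∞) ≠ 0 := by norm_num
  have h32' : (3 / 2 : ℝ≥0∞) ≠ ⊤ := ENNReal.div_ne_top (by norm_num) (by norm_num)
  have h3 := lintegral_rpow_enorm_lt_top_of_eLpNorm_lt_top h32 h32' hp.eLpNorm_lt_top
  have e : (3 / 2 : ℝ≥0∞).toReal = (3 / 2 : ℝ) := by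
    rw [ENNReal.toReal_div]; norm_num
  rw [e] at h3
  exact lt_of_le_of_lt (lintegral_mono_set hS) h3

/-! ### The a.e. Type I bound passes to `L³` limits -/

/-- If `w_j → u` in `L³(μ)` and `√(-t) |w_j| ≤ C` `μ`-a.e. for every `j`, then `√(-t) |u| ≤ C`
`μ`-a.e. (a subsequence converges a.e.). [folklore] -/
theorem ae_typeI_of_tendsto_eLpNorm {μ : Measure (ℝ × EuclideanSpace ℝ (Fin 3))} {C : ℝ}
    {w : ℕ → ℝ → EuclideanSpace ℝ (Fin 3) → EuclideanSpace ℝ (Fin 3)}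
    {u : ℝ → EuclideanSpace ℝ (Fin 3) → EuclideanSpace ℝ (Fin 3)}
    (hwm : ∀ j, AEStronglyMeasurable (uncurry (w j)) μ) (hum : AEStronglyMeasurable (uncurry u) μ)
    (hconv : Tendsto (fun j => eLpNorm (uncurry (w j) - uncurry u) 3 μ) atTop (𝓝 0))
    (hTI : ∀ j, ∀ᵐ z ∂μ, Real.sqrt (-z.1) * ‖w j z.1 z.2‖ ≤ C) :
    ∀ᵐ z ∂μ, Real.sqrt (-z.1) * ‖u z.1 z.2‖ ≤ C := by
  have hT := tendstoInMeasure_of_tendsto_eLpNorm (by norm_num) hwm hum hconv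
  obtain ⟨ns, -, hae⟩ := hT.exists_seq_tendsto_ae
  have hall : ∀ᵐ z ∂μ, ∀ i, Real.sqrt (-z.1) * ‖w (ns i) z.1 z.2‖ ≤ C :=
    ae_all_iff.2 fun i => hTI (ns i)
  filter_upwards [hae, hall] with z hz hzi
  have hlim : Tendsto (fun i => Real.sqrt (-z.1) * ‖uncurry (w (ns i)) z‖) atTop
      (𝓝 (Real.sqrt (-z.1) * ‖uncurry u z‖)) := (hz.norm).const_mul _
  exact le_of_tendsto' hlim fun i => hzi i

end Summit.NavierStokesRegularity.NavierStokesRegularity.Theorems.QuantisedOrder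

end
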